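import Summits.HodgeConjecture.HodgeConjecture.Theorems.Ring2AbelianAllAndrePolarTriplesTop
import HarnessLib

/-!
# Ring 2 · sub-cell AbelianAll (ALL ABELIAN VARIETIES), André axis, part XXXVIII-l — THE MATCHING STEPS WITH FIVE AND SEVEN FREE ONE-FORMS
# (`(k+1) · z₁ ⋯ z_{2p−1} y θᵏ` in the top degree): the first half of the Kleiman identity of the block `b = 3` (abelian-FIVEFOLD pencils)

HONEST FRAMING (page 1, verbatim): **research route, not a corollary; conditional on HC_CM plus one named
minimal statement.** Cell line: research route conditional on HC_CM; not a corollary; Q11.4-sentence-2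
already refuted in dim ≥ 3. Nothing in this file proves a case of the Hodge conjecture; `HC_CM` does not occur.

Gen-30 file of the `ab-andre-2` seat (cell `pub-hodge-ring2`, sub-cell AbelianAll = ALL abelian varieties, not Weil-type-only).

## What this file proves (sorry-free, standard axioms only; RATIONAL Betti carriers, COR-CM model layer)

For `A : AbelianVariety ℂ`, a basis `b` of `H¹(A(ℂ); ℚ)`, `θ` with polar family `y` along `b` (`y_a = D_a θ`, `D_a` the graded derivation of
`H• = ⋀•H¹` extending `b^*_a`), free one-forms `z_i` and all products right-nested:
* `smul_cup6_polar_cupPow` (`k + 3 = dim A`): `(k+1) · z₁ ⋯ z₅ y_e θᵏ = Σ_{i=1}^{5} (−1)^{5−i} b^*_e(z_i) · (z₁ ⋯ ẑ_i ⋯ z₅) θ^{k+1}`;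
* `smul_cup8_polar_cupPow` (`k + 4 = dim A`): `(k+1) · z₁ ⋯ z₇ y_g θᵏ = Σ_{i=1}^{7} (−1)^{7−i} b^*_g(z_i) · (z₁ ⋯ ẑ_i ⋯ z₇) θ^{k+1}`.
Mechanism as in parts XXXVIII-e₁/g: `(k+1) y θᵏ = D(θ^{k+1})`, the Leibniz rule `x ∪ D z = φ(x) z − D(x ∪ z)`, and vanishing above the top
degree. Use (o124, next generation): with `z = (u₁, …, u₄, y_a)` resp. `(u₁, …, u₄, y_a, y_c, y_e)` these are the matching steps of the traced sums
`T_{2,4}` and `T_{4,4}` on `H⁴(A) = ⋀⁴H¹`, whose evaluation (three single-`ℓ` words: `End_{Sp}(⋀⁴H¹) = ⟨id, LΛ, L²Λ²⟩`) gives the Kleiman identity of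
the block `b = 3` and `B⋆` for compact pencils of abelian fivefolds.

PRINT: Kleiman, Dix exposés, App. to §2, 2A8–2A11; [MumfordAV1970, §1 (4), §16]. LEAN: displayed theorems, definition-free, fact-free.
-/

noncomputable section

set_option linter.dupNamespace false

namespace Summit.HodgeConjecture.HodgeConjecture.Ring2.AbelianAll

open CategoryTheory MonoidalCategory CartesianMonoidalCategory
open Literature.AlgebraicTopology.SingularHomology
open Literature.AlgebraicTopology.CharacteristicClasses (cupPow cupPow_zero cupPow_succ)
open Literature.AlgebraicGeometry.Motives (SchemeOver ComplexPoints IsSmoothProjective bettiCohomology AbelianVariety)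
open Literature.AlgebraicGeometry.HodgeTheory
open Summit.HodgeConjecture.CorCM.Model
open scoped MonObj

variable (A : AbelianVariety ℂ)

/-- **The matching step with five free one-forms** (`k + 3 = dim A`): `(k+1) · z₁ z₂ z₃ z₄ z₅ y_e θᵏ = Σ_i (−1)^{5−i} b^*_e(z_i) · (z₁ ⋯ ẑ_i ⋯ z₅) θ^{k+1}` —
part XXXVIII-g's three-pair step with `y_a, y_c` freed (the matching step of the sum `T_{2,4}` of the block `b = 3`). [cite: MumfordAV1970, §16] -/
theorem smul_cup6_polar_cupPow {n k : ℕ} (hk : k + 3 = A.dim) (b : Module.Basis (Fin n) ℚ (bettiCohomology A.X 1))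
    {θ : bettiCohomology A.X 2} {y : Fin n → bettiCohomology A.X 1}
    (hℓ : BettiUniverse.pull μ[A.X] 2 θ - BettiUniverse.pull (fst A.X A.X) 2 θ - BettiUniverse.pull (snd A.X A.X) 2 θ =
      ∑ a, BettiUniverse.cup (A.X ⊗ A.X) 1 1 (BettiUniverse.pull (fst A.X A.X) 1 (b a))
        (BettiUniverse.pull (snd A.X A.X) 1 (y a)))
    (e : Fin n) (z₁ z₂ z₃ z₄ z₅ : bettiCohomology A.X 1) :
    ((k + 1 : ℕ) : ℚ) • cupProduct (Nat.add_comm 1 (2 * k + 1 + 1 + 1 + 1 + 1)) z₁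
          (cupProduct (Nat.add_comm 1 (2 * k + 1 + 1 + 1 + 1)) z₂
            (cupProduct (Nat.add_comm 1 (2 * k + 1 + 1 + 1)) z₃
              (cupProduct (Nat.add_comm 1 (2 * k + 1 + 1)) z₄
                (cupProduct (Nat.add_comm 1 (2 * k + 1)) z₅
                  (cupProduct (show 1 + 2 * k = 2 * k + 1 by omega) (y e) (cupPow ℚ θ k)))))) =
      b.coord e z₅ • cupProduct (Nat.add_comm 1 (2 * k + 1 + 1 + 1 + 1 + 1)) z₁
            (cupProduct (Nat.add_comm 1 (2 * k + 1 + 1 + 1 + 1)) z₂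
              (cupProduct (Nat.add_comm 1 (2 * k + 1 + 1 + 1)) z₃
                (cupProduct (Nat.add_comm 1 (2 * k + 1 + 1)) z₄
                  (cupPow ℚ θ (k + 1))))) -
        b.coord e z₄ • cupProduct (Nat.add_comm 1 (2 * k + 1 + 1 + 1 + 1 + 1)) z₁
            (cupProduct (Nat.add_comm 1 (2 * k + 1 + 1 + 1 + 1)) z₂
              (cupProduct (Nat.add_comm 1 (2 * k + 1 + 1 + 1)) z₃
                (cupProduct (Nat.add_comm 1 (2 * k + 1 + 1)) z₅
                  (cupPow ℚ θ (k + 1))))) +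
        b.coord e z₃ • cupProduct (Nat.add_comm 1 (2 * k + 1 + 1 + 1 + 1 + 1)) z₁
            (cupProduct (Nat.add_comm 1 (2 * k + 1 + 1 + 1 + 1)) z₂
              (cupProduct (Nat.add_comm 1 (2 * k + 1 + 1 + 1)) z₄
                (cupProduct (Nat.add_comm 1 (2 * k + 1 + 1)) z₅
                  (cupPow ℚ θ (k + 1))))) -
        b.coord e z₂ • cupProduct (Nat.add_comm 1 (2 * k + 1 + 1 + 1 + 1 + 1)) z₁
            (cupProduct (Nat.add_comm 1 (2 * k + 1 + 1 + 1 + 1)) z₃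
              (cupProduct (Nat.add_comm 1 (2 * k + 1 + 1 + 1)) z₄
                (cupProduct (Nat.add_comm 1 (2 * k + 1 + 1)) z₅
                  (cupPow ℚ θ (k + 1))))) +
        b.coord e z₁ • cupProduct (Nat.add_comm 1 (2 * k + 1 + 1 + 1 + 1 + 1)) z₂
            (cupProduct (Nat.add_comm 1 (2 * k + 1 + 1 + 1 + 1)) z₃
              (cupProduct (Nat.add_comm 1 (2 * k + 1 + 1 + 1)) z₄
                (cupProduct (Nat.add_comm 1 (2 * k + 1 + 1)) z₅
                  (cupPow ℚ θ (k + 1))))) := by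
  have h := hasExteriorCohomologyH1_rat A
  have hex := fun c : Fin n ↦ exists_contraction h (b.coord c)
  choose D hD using hex
  haveI : Subsingleton (singularCohomology ℚ ℚ (ComplexPoints A.X) (2 * k + 1 + 1 + 1 + 1 + 1 + 1 + 1)) :=
    subsingleton_bettiCohomology_of_lt A (by omega)
  have e0 : ((k + 1 : ℕ) : ℚ) • cupProduct (show 1 + 2 * k = 2 * k + 1 by omega) (y e) (cupPow ℚ θ k) =
      D e (2 * k + 1) (cupPow ℚ θ (k + 1)) := by
    rw [polarFamily_eq_contraction A b hℓ D hD e]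
    exact (contraction_cupPow (b.coord e) (D e) h (hD e) θ k).symm
  have leib : ∀ (d : ℕ) (x : bettiCohomology A.X 1) (z : bettiCohomology A.X (d + 1)),
      cupProduct (Nat.add_comm 1 d) x (D e d z) = b.coord e x • z - D e (d + 1) (cupProduct (Nat.add_comm 1 (d + 1)) x z) := by
    intro d x z
    rw [contraction_cup_one (b.coord e) (D e) h (hD e) d x z, sub_sub_cancel]
  have htop : cupProduct (Nat.add_comm 1 (2 * k + 1 + 1 + 1 + 1 + 1 + 1)) z₁
        (cupProduct (Nat.add_comm 1 (2 * k + 1 + 1 + 1 + 1 + 1)) z₂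
          (cupProduct (Nat.add_comm 1 (2 * k + 1 + 1 + 1 + 1)) z₃
            (cupProduct (Nat.add_comm 1 (2 * k + 1 + 1 + 1)) z₄
              (cupProduct (Nat.add_comm 1 (2 * k + 1 + 1)) z₅
                (cupPow ℚ θ (k + 1)))))) = 0 :=
    Subsingleton.elim _ _
  rw [← map_smul, ← map_smul, ← map_smul, ← map_smul, ← map_smul, e0]
  simp only [leib, map_sub, map_smul, htop, map_zero, sub_zero]
  abel

/-- **THE FOUR-PAIR MATCHING STEP** (`k + 4 = dim A`): `(k+1) · z₁ ⋯ z₇ y_g θᵏ = Σ_i (−1)^{7−i} b^*_g(z_i) · (z₁ ⋯ ẑ_i ⋯ z₇) θ^{k+1}` for seven free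
one-forms — `(k+1) y_g θᵏ = D_g(θ^{k+1})`, seven Leibniz steps, `z₁ ⋯ z₇ θ^{k+1} = 0` above the top degree; the matching step of the sum `T_{4,4}`
of the block `b = 3` (abelian-FIVEFOLD pencils). [cite: MumfordAV1970, §16] [cite: Kleiman1968AlgebraicCycles, App. to §2, 2A8–2A10] -/
theorem smul_cup8_polar_cupPow {n k : ℕ} (hk : k + 4 = A.dim) (b : Module.Basis (Fin n) ℚ (bettiCohomology A.X 1))
    {θ : bettiCohomology A.X 2} {y : Fin n → bettiCohomology A.X 1}
    (hℓ : BettiUniverse.pull μ[A.X] 2 θ - BettiUniverse.pull (fst A.X A.X) 2 θ - BettiUniverse.pull (snd A.X A.X) 2 θ =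
      ∑ a, BettiUniverse.cup (A.X ⊗ A.X) 1 1 (BettiUniverse.pull (fst A.X A.X) 1 (b a))
        (BettiUniverse.pull (snd A.X A.X) 1 (y a)))
    (g : Fin n) (z₁ z₂ z₃ z₄ z₅ z₆ z₇ : bettiCohomology A.X 1) :
    ((k + 1 : ℕ) : ℚ) • cupProduct (Nat.add_comm 1 (2 * k + 1 + 1 + 1 + 1 + 1 + 1 + 1)) z₁
          (cupProduct (Nat.add_comm 1 (2 * k + 1 + 1 + 1 + 1 + 1 + 1)) z₂
            (cupProduct (Nat.add_comm 1 (2 * k + 1 + 1 + 1 + 1 + 1)) z₃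
              (cupProduct (Nat.add_comm 1 (2 * k + 1 + 1 + 1 + 1)) z₄
                (cupProduct (Nat.add_comm 1 (2 * k + 1 + 1 + 1)) z₅
                  (cupProduct (Nat.add_comm 1 (2 * k + 1 + 1)) z₆
                    (cupProduct (Nat.add_comm 1 (2 * k + 1)) z₇
                      (cupProduct (show 1 + 2 * k = 2 * k + 1 by omega) (y g) (cupPow ℚ θ k)))))))) =
      b.coord g z₇ • cupProduct (Nat.add_comm 1 (2 * k + 1 + 1 + 1 + 1 + 1 + 1 + 1)) z₁
            (cupProduct (Nat.add_comm 1 (2 * k + 1 + 1 + 1 + 1 + 1 + 1)) z₂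
              (cupProduct (Nat.add_comm 1 (2 * k + 1 + 1 + 1 + 1 + 1)) z₃
                (cupProduct (Nat.add_comm 1 (2 * k + 1 + 1 + 1 + 1)) z₄
                  (cupProduct (Nat.add_comm 1 (2 * k + 1 + 1 + 1)) z₅
                    (cupProduct (Nat.add_comm 1 (2 * k + 1 + 1)) z₆
                      (cupPow ℚ θ (k + 1))))))) -
        b.coord g z₆ • cupProduct (Nat.add_comm 1 (2 * k + 1 + 1 + 1 + 1 + 1 + 1 + 1)) z₁
            (cupProduct (Nat.add_comm 1 (2 * k + 1 + 1 + 1 + 1 + 1 + 1)) z₂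
              (cupProduct (Nat.add_comm 1 (2 * k + 1 + 1 + 1 + 1 + 1)) z₃
                (cupProduct (Nat.add_comm 1 (2 * k + 1 + 1 + 1 + 1)) z₄
                  (cupProduct (Nat.add_comm 1 (2 * k + 1 + 1 + 1)) z₅
                    (cupProduct (Nat.add_comm 1 (2 * k + 1 + 1)) z₇
                      (cupPow ℚ θ (k + 1))))))) +
        b.coord g z₅ • cupProduct (Nat.add_comm 1 (2 * k + 1 + 1 + 1 + 1 + 1 + 1 + 1)) z₁
            (cupProduct (Nat.add_comm 1 (2 * k + 1 + 1 + 1 + 1 + 1 + 1)) z₂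
              (cupProduct (Nat.add_comm 1 (2 * k + 1 + 1 + 1 + 1 + 1)) z₃
                (cupProduct (Nat.add_comm 1 (2 * k + 1 + 1 + 1 + 1)) z₄
                  (cupProduct (Nat.add_comm 1 (2 * k + 1 + 1 + 1)) z₆
                    (cupProduct (Nat.add_comm 1 (2 * k + 1 + 1)) z₇
                      (cupPow ℚ θ (k + 1))))))) -
        b.coord g z₄ • cupProduct (Nat.add_comm 1 (2 * k + 1 + 1 + 1 + 1 + 1 + 1 + 1)) z₁
            (cupProduct (Nat.add_comm 1 (2 * k + 1 + 1 + 1 + 1 + 1 + 1)) z₂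
              (cupProduct (Nat.add_comm 1 (2 * k + 1 + 1 + 1 + 1 + 1)) z₃
                (cupProduct (Nat.add_comm 1 (2 * k + 1 + 1 + 1 + 1)) z₅
                  (cupProduct (Nat.add_comm 1 (2 * k + 1 + 1 + 1)) z₆
                    (cupProduct (Nat.add_comm 1 (2 * k + 1 + 1)) z₇
                      (cupPow ℚ θ (k + 1))))))) +
        b.coord g z₃ • cupProduct (Nat.add_comm 1 (2 * k + 1 + 1 + 1 + 1 + 1 + 1 + 1)) z₁
            (cupProduct (Nat.add_comm 1 (2 * k + 1 + 1 + 1 + 1 + 1 + 1)) z₂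
              (cupProduct (Nat.add_comm 1 (2 * k + 1 + 1 + 1 + 1 + 1)) z₄
                (cupProduct (Nat.add_comm 1 (2 * k + 1 + 1 + 1 + 1)) z₅
                  (cupProduct (Nat.add_comm 1 (2 * k + 1 + 1 + 1)) z₆
                    (cupProduct (Nat.add_comm 1 (2 * k + 1 + 1)) z₇
                      (cupPow ℚ θ (k + 1))))))) -
        b.coord g z₂ • cupProduct (Nat.add_comm 1 (2 * k + 1 + 1 + 1 + 1 + 1 + 1 + 1)) z₁
            (cupProduct (Nat.add_comm 1 (2 * k + 1 + 1 + 1 + 1 + 1 + 1)) z₃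
              (cupProduct (Nat.add_comm 1 (2 * k + 1 + 1 + 1 + 1 + 1)) z₄
                (cupProduct (Nat.add_comm 1 (2 * k + 1 + 1 + 1 + 1)) z₅
                  (cupProduct (Nat.add_comm 1 (2 * k + 1 + 1 + 1)) z₆
                    (cupProduct (Nat.add_comm 1 (2 * k + 1 + 1)) z₇
                      (cupPow ℚ θ (k + 1))))))) +
        b.coord g z₁ • cupProduct (Nat.add_comm 1 (2 * k + 1 + 1 + 1 + 1 + 1 + 1 + 1)) z₂
            (cupProduct (Nat.add_comm 1 (2 * k + 1 + 1 + 1 + 1 + 1 + 1)) z₃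
              (cupProduct (Nat.add_comm 1 (2 * k + 1 + 1 + 1 + 1 + 1)) z₄
                (cupProduct (Nat.add_comm 1 (2 * k + 1 + 1 + 1 + 1)) z₅
                  (cupProduct (Nat.add_comm 1 (2 * k + 1 + 1 + 1)) z₆
                    (cupProduct (Nat.add_comm 1 (2 * k + 1 + 1)) z₇
                      (cupPow ℚ θ (k + 1))))))) := by
  have h := hasExteriorCohomologyH1_rat A
  have hex := fun c : Fin n ↦ exists_contraction h (b.coord c)
  choose D hD using hex
  haveI : Subsingleton (singularCohomology ℚ ℚ (ComplexPoints A.X) (2 * k + 1 + 1 + 1 + 1 + 1 + 1 + 1 + 1 + 1)) :=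
    subsingleton_bettiCohomology_of_lt A (by omega)
  have e0 : ((k + 1 : ℕ) : ℚ) • cupProduct (show 1 + 2 * k = 2 * k + 1 by omega) (y g) (cupPow ℚ θ k) =
      D g (2 * k + 1) (cupPow ℚ θ (k + 1)) := by
    rw [polarFamily_eq_contraction A b hℓ D hD g]
    exact (contraction_cupPow (b.coord g) (D g) h (hD g) θ k).symm
  have leib : ∀ (d : ℕ) (x : bettiCohomology A.X 1) (z : bettiCohomology A.X (d + 1)),
      cupProduct (Nat.add_comm 1 d) x (D g d z) = b.coord g x • z - D g (d + 1) (cupProduct (Nat.add_comm 1 (d + 1)) x z) := by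
    intro d x z
    rw [contraction_cup_one (b.coord g) (D g) h (hD g) d x z, sub_sub_cancel]
  have htop : cupProduct (Nat.add_comm 1 (2 * k + 1 + 1 + 1 + 1 + 1 + 1 + 1 + 1)) z₁
        (cupProduct (Nat.add_comm 1 (2 * k + 1 + 1 + 1 + 1 + 1 + 1 + 1)) z₂
          (cupProduct (Nat.add_comm 1 (2 * k + 1 + 1 + 1 + 1 + 1 + 1)) z₃
            (cupProduct (Nat.add_comm 1 (2 * k + 1 + 1 + 1 + 1 + 1)) z₄
              (cupProduct (Nat.add_comm 1 (2 * k + 1 + 1 + 1 + 1)) z₅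
                (cupProduct (Nat.add_comm 1 (2 * k + 1 + 1 + 1)) z₆
                  (cupProduct (Nat.add_comm 1 (2 * k + 1 + 1)) z₇
                    (cupPow ℚ θ (k + 1)))))))) = 0 :=
    Subsingleton.elim _ _
  rw [← map_smul, ← map_smul, ← map_smul, ← map_smul, ← map_smul, ← map_smul, ← map_smul, e0]
  simp only [leib, map_sub, map_smul, htop, map_zero, sub_zero]
  abel

end Summit.HodgeConjecture.HodgeConjecture.Ring2.AbelianAll

end
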